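import Summits.CriticalPhenomena.PercolationContinuityZ3.Theorems.PercNearOneGluingNoHeavyQuantTwoBlobTopFlippedLightHeavy
import HarnessLib

/-!
# QUANT lane R8, T-DEC, leg (III) / PM⁻ TRANSPORT CELL: the piece "TWO BLOBS UNDER A GATE" (atoms `0, a, h, h+a`) at a PRESCRIBED
# floor, target and layer — the single-low cell in closed (capacity) form, for FREE masses, for the gate-zero share `θ`, and for the
# two-budget form `(u, v)`

builds on p205010 (kernel theorem, internal audit signed; external expert review pending)

Support file (`--supports stmt-CriticalPhenomena-4575`), QUANT lane seat prim-quant-arm-1 (gen 38), rung R8 of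
`run/shared/lean/prim/quant/LADDER.md`; the lead's ask '→ arm-1: take PM⁻ TRANSPORT CELL' (lane INBOX 2026-08-22T12:12Z,
LEAD-NOTES-G27 N77 (c)/(c′), FOR-PROVERS-GATE-STEP §3).  Theorems only, standard axioms, no sorries, no definitions.  Memo
`run/shared/lean/prim/quant/prim-quant-arm-1-g38/PM-TRANSPORT-CELL-G38.md` (exact engines in `…/code/`).

THE PIECE.  In the piece route to PM⁻ (`P = gate_q(slice μ a g)`, N77 (c)) every ZERO COMPONENT `{0, h; γ}` of the datum of `ν = gate_q μ`
becomes, after hanging the blob `(a, g)` beside it and charging it a share of the gate-zero move `(1−q)g·(δ₀ − δ_a)`, the four-atom law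
`Π = m₀δ₀ + m_a δ_a + m_h δ_h + m_t δ_{h+a}` with `m₀ = (1−γ)(1−g) + u`, `m_a = (1−γ)g − v`, `m_h = γ(1−g)`, `m_t = γg`
(`u` = zero mass absorbed, `v` = `a`-mass released; the θ-coupled form of N77 (c) is `u = v = (1−γ)gθ`, i.e. `Π(θ)` = two blobs
`(h, γ/σ)`, `(a, g)` under a gate `σ = 1 − θ(1−γ)`).  It must be DEC at the PRESCRIBED floor `y = qx`, target `t = q(T + ag)` and layer `j`
of the whole law — none of which is a function of the piece.  EXACT CENSUS (memo §2–§4; lead's instance set seed 23, 4 160 tree + 9 895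
general instances, datum of `ν` = kernel corner run at the giant-free layer `j′ = max(j, M)`): among the 28 239 distinct cells the
binding ones (`θ^max < 1`) are, apart from 25 two-low cells, exactly the SINGLE-LOW cells — `a` self-sufficient at `(t, j)`
(`t ≤ 2a` or `a ≥ j+1`), `h` self-sufficient — where DEC is ONE linear inequality by typer g23's `LawDec.decAtT_singleLow_iff`:
`(y/(1−y))·m₀ ≤ C_a m_a + C_h m_h + C_{h+a} m_t`, `C_k = capCoef y t j 0 k` (`1` on giants, `(y/(1−y))/usage(0,k)` on compatible mids
`t < k ≤ j`, `0` otherwise).  This file states that cell once for FREE masses (so that both parametrisations are instances), gives the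
two closed forms of `C_k` for a mid, and the two corollaries.
* `LawDec.capCoef0_eq_heavy` / `capCoef0_eq_light` — `C_k = (y/(1−y))·(k − t)/t` (`yk ≤ t < k ≤ j`) resp.
  `C_k = y((1+y)k − t)/(y²k + (1−y)t)` (`t ≤ yk`, `t < k ≤ j`).
* **`LawDec.fourAtom_decAtT_singleLow`** — masses `m ≥ 0` of total `1`, `0 < t`, `a` and `h` self-sufficient at `(t, j)`, and the capacity
  inequality ⟹ `DECAtT y t j (h + a) Π`.
* **`LawDec.twoBlobGate_decAtT_singleLow`** — the θ-form: `0 ≤ γ, g, θ ≤ 1` and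
  `(y/(1−y))(1−γ)(1 − g(1−θ)) ≤ C_a(1−γ)g(1−θ) + C_h γ(1−g) + C_{h+a} γg`, i.e. `θ ≤ θ^max` with
  **`θ^max = [C_a(1−γ)g + C_hγ(1−g) + C_{h+a}γg − (y/(1−y))(1−γ)(1−g)] / [(1−γ)g(y/(1−y) + C_a)]`** (memo §3 (i)).
* **`LawDec.twoBlobGate_decAtT_singleLow_uv`** — the two-budget form (memo §4: with `u`, `v` distributed by two INDEPENDENT budgets the
  piece route certifies 4 160/4 160 + 9 895/9 895 instances at every layer): masses `(1−γ)(1−g) + u, (1−γ)g − v, γ(1−g), γg` normalised by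
  their total `1 + u − v`.

[this work]; DEC rules ARCH-TREES-G49 §2.2 / DEC-TAMP-G50 §3.1, `…QuantSingleLowCapacity` (typer g23), `…QuantLowCapacity` (lead g22),
the capCoef closed forms of `…QuantTwoBlobTopFlippedLightHeavy` (arm-2 g31) — this lane.  Nothing here is cited as a published result.
The gluing rows served [cite: KozmaNitzan2024, Conjecture 3 (p. 15)]; product measure [cite: Grimmett1999, §1.3 p. 10].
-/

noncomputable section

namespace Summit.CriticalPhenomena.PercolationContinuityZ3.Theorems

namespace Quant

open Finset

/-- the four-atom law `m₀δ₀ + m_a δ_a + m_h δ_h + m_t δ_{h+a}` evaluated at `k` -/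
local notation3 "ATOM4[" a ", " h ", " m0 ", " ma ", " mh ", " mt ", " k "]" =>
  (m0 : ℝ) * (if (k : ℕ) = 0 then (1 : ℝ) else 0) + (ma : ℝ) * (if (k : ℕ) = (a : ℕ) then (1 : ℝ) else 0)
    + (mh : ℝ) * (if (k : ℕ) = (h : ℕ) then (1 : ℝ) else 0) + (mt : ℝ) * (if (k : ℕ) = (h : ℕ) + (a : ℕ) then (1 : ℝ) else 0)

namespace LawDec

/-! ### Closed forms of the capacity coefficient of a mid for the low atom `0` -/

/-- **capCoef of a compatible mid for the low `0`, HEAVY side**: `y·k ≤ t < k ≤ j`, `0 < y < 1` ⟹ `capCoef y t j 0 k = (y/(1−y))·(k − t)/t`.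
[this work] -/
theorem capCoef0_eq_heavy (y t : ℝ) (j k : ℕ) (hy0 : 0 < y) (hy1 : y < 1) (hkj : k ≤ j) (ht : 0 < t) (htk : t < (k : ℝ))
    (hρ : y * (k : ℝ) ≤ t) : capCoef y t j 0 k = y / (1 - y) * (((k : ℝ) - t) / t) := by
  have hnotg : ¬ (j + 1 ≤ k) := by omega
  unfold capCoef
  rw [if_neg hnotg, if_pos ⟨by linarith, by simpa using htk⟩, usage0_eq_heavy y t j k hy0 hy1 hkj ht htk hρ]
  have hkt : (0 : ℝ) < (k : ℝ) - t := by linarith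
  field_simp

/-- **capCoef of a compatible mid for the low `0`, LIGHT side**: `t ≤ y·k`, `t < k ≤ j`, `0 < t`, `0 < y < 1` ⟹
`capCoef y t j 0 k = y((1+y)k − t)/(y²k + (1−y)t)`. [this work] -/
theorem capCoef0_eq_light (y t : ℝ) (j k : ℕ) (hy0 : 0 < y) (hy1 : y < 1) (hkj : k ≤ j) (ht : 0 < t) (htk : t < (k : ℝ))
    (hρ : t ≤ y * (k : ℝ)) : capCoef y t j 0 k = y * ((1 + y) * (k : ℝ) - t) / (y ^ 2 * (k : ℝ) + (1 - y) * t) := by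
  have hnotg : ¬ (j + 1 ≤ k) := by omega
  unfold capCoef
  rw [if_neg hnotg, if_pos ⟨by linarith, by simpa using htk⟩, usage0_eq_light y t j k hy0 hy1 hkj ht htk hρ]
  have h1 : (0 : ℝ) < 1 - y := by linarith
  have h2 : (0 : ℝ) < (1 + y) * (k : ℝ) - t := by nlinarith
  have h3 : (0 : ℝ) < y ^ 2 * (k : ℝ) + (1 - y) * t := by positivity
  field_simp

/-! ### The single-low four-atom cell -/

/-- **THE SINGLE-LOW CELL FOR FREE MASSES.**  Law `Π = m₀δ₀ + m_aδ_a + m_hδ_h + m_tδ_{h+a}` with `m ≥ 0` of total `1`; floor `0 < y < 1`,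
target `0 < t`, layer `j`; the atoms `a` and `h` (hence `h + a`) SELF-SUFFICIENT at `(t, j)` (`t ≤ 2a ∨ j+1 ≤ a`, `t ≤ 2h ∨ j+1 ≤ h`), so
that `0` is the only low atom; and the CAPACITY INEQUALITY `(y/(1−y))·m₀ ≤ C_a m_a + C_h m_h + C_{h+a} m_t` (`C = capCoef y t j 0 ·`)
⟹ `DECAtT y t j (h + a) Π` (typer g23's `decAtT_singleLow_iff`, sums evaluated).  Coincidences `h = a` are allowed. [this work] -/
theorem fourAtom_decAtT_singleLow (y t m0 ma mh mt : ℝ) (j a h : ℕ) (hy0 : 0 < y) (hy1 : y < 1)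
    (hm0 : 0 ≤ m0) (hma : 0 ≤ ma) (hmh : 0 ≤ mh) (hmt : 0 ≤ mt) (hsum : m0 + ma + mh + mt = 1) (ht : 0 < t)
    (haS : t ≤ 2 * (a : ℝ) ∨ j + 1 ≤ a) (hhS : t ≤ 2 * (h : ℝ) ∨ j + 1 ≤ h)
    (hcap : y / (1 - y) * m0 ≤ capCoef y t j 0 a * ma + capCoef y t j 0 h * mh + capCoef y t j 0 (h + a) * mt) :
    DECAtT y t j (h + a) (fun k => ATOM4[a, h, m0, ma, mh, mt, k]) := by
  classical
  have ind_nn : ∀ (P : Prop) [Decidable P], (0:ℝ) ≤ (if P then (1:ℝ) else 0) := fun P _ => by split_ifs <;> norm_num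
  -- the self-sufficient atoms are not low
  have hnotlow : ∀ k, k ≤ j → 2 * (k : ℝ) < t → k ≠ a ∧ k ≠ h ∧ k ≠ h + a := by
    intro k hkj hk
    refine ⟨?_, ?_, ?_⟩
    · rintro rfl
      rcases haS with h2 | hg
      · linarith
      · omega
    · rintro rfl
      rcases hhS with h2 | hg
      · linarith
      · omega
    · rintro rfl
      rcases hhS with h2 | hg
      · push_cast at hk; linarith [(Nat.cast_nonneg a : (0:ℝ) ≤ a)]
      · omega
  have hlaw0 : ∀ k, 0 ≤ ATOM4[a, h, m0, ma, mh, mt, k] := by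
    intro k
    have := mul_nonneg hm0 (ind_nn (k = 0)); have := mul_nonneg hma (ind_nn (k = a))
    have := mul_nonneg hmh (ind_nn (k = h)); have := mul_nonneg hmt (ind_nn (k = h + a))
    linarith
  have hlawM : ∀ k, h + a < k → ATOM4[a, h, m0, ma, mh, mt, k] = 0 := by
    intro k hk
    rw [if_neg (by omega), if_neg (by omega), if_neg (by omega), if_neg (by omega)]
    ring
  have hlaw1 : ∑ k ∈ Finset.range (h + a + 1), ATOM4[a, h, m0, ma, mh, mt, k] = 1 := by
    rw [Finset.sum_add_distrib, Finset.sum_add_distrib, Finset.sum_add_distrib,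
      BlobDec2.sum_range_const_indicator _ 0 (Nat.zero_le _) m0, BlobDec2.sum_range_const_indicator _ a (Nat.le_add_left a h) ma,
      BlobDec2.sum_range_const_indicator _ h (Nat.le_add_right h a) mh, BlobDec2.sum_range_const_indicator _ (h + a) le_rfl mt]
    exact hsum
  have hsingle : ∀ k, k ≤ j → 2 * (k : ℝ) < t → k ≠ 0 → ATOM4[a, h, m0, ma, mh, mt, k] = 0 := by
    intro k hkj hk hk0
    obtain ⟨h1, h2, h3⟩ := hnotlow k hkj hk
    rw [if_neg hk0, if_neg h1, if_neg h2, if_neg h3]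
    ring
  have hcap' : y / (1 - y) * ATOM4[a, h, m0, ma, mh, mt, 0] ≤
      ∑ k ∈ Finset.range (h + a + 1), capCoef y t j 0 k * ATOM4[a, h, m0, ma, mh, mt, k] := by
    have ha0 : a ≠ 0 := by
      rintro rfl
      rcases haS with h2 | hg
      · simp at h2; linarith
      · omega
    have hh0 : h ≠ 0 := by
      rintro rfl
      rcases hhS with h2 | hg
      · simp at h2; linarith
      · omega
    have e0 : ATOM4[a, h, m0, ma, mh, mt, 0] = m0 := by
      rw [if_pos rfl, if_neg (Ne.symm ha0), if_neg (Ne.symm hh0), if_neg (by omega)]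
      ring
    have esum : ∑ k ∈ Finset.range (h + a + 1), capCoef y t j 0 k * ATOM4[a, h, m0, ma, mh, mt, k] =
        capCoef y t j 0 0 * m0 + capCoef y t j 0 a * ma + capCoef y t j 0 h * mh + capCoef y t j 0 (h + a) * mt := by
      simp only [mul_add]
      rw [Finset.sum_add_distrib, Finset.sum_add_distrib, Finset.sum_add_distrib]
      rw [sum_range_mul_const_indicator _ 0 (Nat.zero_le _), sum_range_mul_const_indicator _ a (Nat.le_add_left a h),
        sum_range_mul_const_indicator _ h (Nat.le_add_right h a), sum_range_mul_const_indicator _ (h + a) le_rfl]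
    rw [e0, esum, capCoef_zero_self y t j ht, zero_mul, zero_add]
    exact hcap
  exact (decAtT_singleLow_iff y t j (h + a) 0 _ hy0 hy1 hlaw0 hlawM hlaw1 (Nat.zero_le j) (by simpa using ht) hsingle).2 hcap'

/-! ### The θ-form: two blobs under a gate carrying the gate-zero share `θ` -/

/-- **THE PM⁻ TRANSPORT CELL, SINGLE-LOW, θ-FORM** (N77 (c)): the zero piece `Π(θ)` — masses `(1−γ)(1 − g(1−θ))`, `(1−γ)g(1−θ)`, `γ(1−g)`,
`γg` at `0, a, h, h+a` (two blobs `(h, γ/σ)`, `(a, g)` under the gate `σ = 1 − θ(1−γ)`) — is `DECAtT y t j (h+a)` at any prescribed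
`(y, t, j)` at which `a` and `h` are self-sufficient, as soon as `θ ≤ θ^max`, written as the capacity inequality
`(y/(1−y))(1−γ)(1 − g(1−θ)) ≤ C_a(1−γ)g(1−θ) + C_hγ(1−g) + C_{h+a}γg`. [this work] -/
theorem twoBlobGate_decAtT_singleLow (y t γ g θ : ℝ) (j a h : ℕ) (hy0 : 0 < y) (hy1 : y < 1)
    (hγ0 : 0 ≤ γ) (hγ1 : γ ≤ 1) (hg0 : 0 ≤ g) (hg1 : g ≤ 1) (hθ0 : 0 ≤ θ) (hθ1 : θ ≤ 1) (ht : 0 < t)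
    (haS : t ≤ 2 * (a : ℝ) ∨ j + 1 ≤ a) (hhS : t ≤ 2 * (h : ℝ) ∨ j + 1 ≤ h)
    (hcap : y / (1 - y) * ((1 - γ) * (1 - g * (1 - θ))) ≤
      capCoef y t j 0 a * ((1 - γ) * g * (1 - θ)) + capCoef y t j 0 h * (γ * (1 - g)) + capCoef y t j 0 (h + a) * (γ * g)) :
    DECAtT y t j (h + a) (fun k => ATOM4[a, h, (1 - γ) * (1 - g * (1 - θ)), (1 - γ) * g * (1 - θ), γ * (1 - g), γ * g, k]) := by
  refine fourAtom_decAtT_singleLow y t _ _ _ _ j a h hy0 hy1 ?_ ?_ ?_ ?_ (by ring) ht haS hhS hcap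
  · have : 0 ≤ 1 - g * (1 - θ) := by nlinarith
    exact mul_nonneg (by linarith) this
  · exact mul_nonneg (mul_nonneg (by linarith) hg0) (by linarith)
  · exact mul_nonneg hγ0 (by linarith)
  · exact mul_nonneg hγ0 hg0

/-! ### The two-budget form: zero mass `u` absorbed, `a`-mass `v` released, normalised -/

/-- **THE PM⁻ TRANSPORT CELL, SINGLE-LOW, TWO-BUDGET FORM** (memo §4): the piece `blob ∗ {0,h;γ} + uδ₀ − vδ_a` — masses
`(1−γ)(1−g) + u`, `(1−γ)g − v`, `γ(1−g)`, `γg` (`u ≥ 0`, `v ≤ (1−γ)g`, total `S = 1 + u − v > 0`), normalised by `S` — is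
`DECAtT y t j (h+a)` at any prescribed `(y, t, j)` at which `a` and `h` are self-sufficient, as soon as `(u, v)` satisfies the (linear)
capacity inequality `(y/(1−y))((1−γ)(1−g) + u) ≤ C_a((1−γ)g − v) + C_hγ(1−g) + C_{h+a}γg`. [this work] -/
theorem twoBlobGate_decAtT_singleLow_uv (y t γ g u v : ℝ) (j a h : ℕ) (hy0 : 0 < y) (hy1 : y < 1)
    (hγ0 : 0 ≤ γ) (hγ1 : γ ≤ 1) (hg0 : 0 ≤ g) (hg1 : g ≤ 1) (hu : 0 ≤ u) (hv : v ≤ (1 - γ) * g)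
    (hS : 0 < 1 + u - v) (ht : 0 < t) (haS : t ≤ 2 * (a : ℝ) ∨ j + 1 ≤ a) (hhS : t ≤ 2 * (h : ℝ) ∨ j + 1 ≤ h)
    (hcap : y / (1 - y) * ((1 - γ) * (1 - g) + u) ≤
      capCoef y t j 0 a * ((1 - γ) * g - v) + capCoef y t j 0 h * (γ * (1 - g)) + capCoef y t j 0 (h + a) * (γ * g)) :
    DECAtT y t j (h + a) (fun k => ATOM4[a, h, ((1 - γ) * (1 - g) + u) / (1 + u - v), ((1 - γ) * g - v) / (1 + u - v),
      γ * (1 - g) / (1 + u - v), γ * g / (1 + u - v), k]) := by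
  have h1 : 0 ≤ (1 - γ) * (1 - g) + u := by nlinarith
  have h2 : 0 ≤ (1 - γ) * g - v := by linarith
  have h3 : 0 ≤ γ * (1 - g) := mul_nonneg hγ0 (by linarith)
  have h4 : 0 ≤ γ * g := mul_nonneg hγ0 hg0
  refine fourAtom_decAtT_singleLow y t _ _ _ _ j a h hy0 hy1 (div_nonneg h1 hS.le) (div_nonneg h2 hS.le) (div_nonneg h3 hS.le)
    (div_nonneg h4 hS.le) ?_ ht haS hhS ?_
  · field_simp
    ring
  · have hc := capCoef_nonneg y t j 0
    rw [show y / (1 - y) * (((1 - γ) * (1 - g) + u) / (1 + u - v)) = (y / (1 - y) * ((1 - γ) * (1 - g) + u)) / (1 + u - v) by ring,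
      show capCoef y t j 0 a * (((1 - γ) * g - v) / (1 + u - v)) + capCoef y t j 0 h * (γ * (1 - g) / (1 + u - v)) +
          capCoef y t j 0 (h + a) * (γ * g / (1 + u - v)) =
        (capCoef y t j 0 a * ((1 - γ) * g - v) + capCoef y t j 0 h * (γ * (1 - g)) + capCoef y t j 0 (h + a) * (γ * g)) /
          (1 + u - v) by ring]
    exact div_le_div_of_nonneg_right hcap hS.le

end LawDec

end Quant

end Summit.CriticalPhenomena.PercolationContinuityZ3.Theorems
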